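import Summits.QuantumFields.YangMills.Theorems.BalabanUVNodesSpineRates
import Summits.QuantumFields.YangMills.Theorems.BalabanUVNodesN16ConstantOfRecord
import HarnessLib

/-!
# Route «BalabanUVNodes», cluster K4 «SpineRates» — node N16 = NE3 «AT THE RECORD»: the stub `S_N16 RRec` READ (`Iff.rfl`), ANTITONE in the
# rate-record predicate, CLOSED for every `RRec` that pins NE3's carriers inside THE END's regime at which the N05∕N07 interfaces hold
# (refinement-generic), with the INHABITED rider (flat stratum) and the vacuity note; and the face the K5 consumers read at a bundle of record

Cell `pub-ymgap`, seat `pub-ymgap-dag-n16-a` (KNIT-BY-NAME, HUMAN RULING D-0062; chair R424 venue), generation 3, file 5 — the node's «AT-RECORD» module in the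
(W2) SHAPE OF RECORD (plan g62 [YMPLAN-G62-WORD-MODULES + W2], dag-lead [WORDS-42]; model `BalabanUVNodesN04AtRecord`, K4 analogue n14-a's `…N14AtRecord`),
now that module 2 `BalabanUVNodesSpineRates` (p418381, courier dag-p2; dagwriter g83 bytes 32834efdae424a70) is in the tree.  `bears_on: R4∕N16`.  Filed
`--supports stmt-QuantumFields-19182` (K4 = spine side).

THE OBJECTS (module 2, BY NAME).  `YMDAG.UVSplit.NE3Carriers N` = N16's carrier bundle `⟨L, Nper, ε, b, g, C, Λ₁, Λ₂', dom⟩`; `N16At c :=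
NE3EnergyRateWCov 4 (sfClass 4 c.L c.Nper c.ε) c.L c.Nper c.b c.g c.C c.Λ₁ c.Λ₂' c.dom` (N16's record decl at the bundle); `RateRecordPred N` = the PARAMETER
«`R` are the rate carriers of record for `(F, D, g₀, os)`» (NODE 00's later-stage definition, R422 (A)(P2) — NO home in the tree yet); `S_N16 RRec := ∀ F D g₀ os R,
RRec F D g₀ os R → N16At R.ne3`.

CONTENT (0 `def`, 0 `sorry`; everything by name):
§1 READINGS — `s_N16_iff` (`Iff.rfl`), `n16At_iff` (`Iff.rfl`), `s_N16_antitone` (refinement of `RRec`), `ratesAt_n16` (projection of `RatesAt`), `n16At_mono`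
(the three constants).
§2 CLOSERS, REFINEMENT-GENERIC (no `RRec` home exists, so the closers are stated over EVERY `RRec` carrying the slot): `n16At_of_pinned` — THE SLOT: there are
`r > 0` and `Cof : ℝ → ℝ≥0` (functions of `(L, Nper, N)` — file 1's `n16_constant_of_record`) such that every bundle `c` with `c.L = L`, `c.Nper = Nper`, `0 < c.g`,
`0 < c.ε ≤ r`, `0 ≤ c.Λ₁ ≤ r`, `0 ≤ c.b ≤ c.ε∕2`, `Cof c.g ≤ c.C` at which the N05 interface `PairLandauGaugeB8Avg 4 (sfClass …) … c.Λ₁ c.Λ₂' 1 c.dom` and the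
N07 interface `LeafH3sup 4 … b′ c′ c.dom` (leaf letters on their two lines) hold satisfies `N16At c`; **`s_N16_of_pinned`** — `S_N16 RRec` for every `RRec`
whose bundles of record carry that slot (what NODE 00's instancing of `NE3Carriers` must supply: ONE clause per bundle); `s_N16_of_refines_pinned` (one
application per refinement).  The two interfaces inside the slot reduce further BY NAME (files 2–4: (1.37) ⇐ (1.29); N05 ⇐ [B8] Thm 4's `Thm4At` at the pair
backgrounds with `Reg := Reg335Zd` ∧ the Concl-dictionary) — not restated here.
§3 GUARDS — `n16At_flatStratum`: the bundle whose datum set is the FLAT STRATUM `FS_N` of the genuine class satisfies `N16At` for all `C, Λ₁, Λ₂' ≥ 0`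
(g0's `n16_flatStratum`: INHABITED rider — `S_N16` is not only closable over empty predicates); `s_N16_flatRecord`: hence `S_N16` HOLDS for the (toy)
rate-record predicate «`R.ne3` is a flat-stratum bundle with nonnegative constants» — an INHABITED `RRec` at which the stub is a theorem; `s_N16_of_empty`: the
empty predicate closes vacuously (why the rider matters; K4's existence content is `S_R00x`, not `S_N16`).
§4 THE FACE AT THE RECORD — `covRoot_at_record`: under `S_N16 RRec`, at every bundle of record the covariant root `NE3EnergyRateWCov 4 (sfClass 4 L Nper ε) …`
that N19∕N21 consume (`CovariantRoot.closeness_of_ne3EnergyRateWCov`, `BalabanUVNodesN21SlotSupJunction`) — `Iff.rfl` bookkeeping.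

HONEST FRAMING.  By-name bookkeeping over module 2's definitions and the seat's landed knits; `S_N16` is NOT proved for the record's `RRec` (none exists); the
slot's two interfaces are [Balaban1985RegularSpaces] Thm 2∕4 ∘ [Balaban1985Variational] Thm 1 TYPE hypotheses; **N16 ∕ NE3 is NOT discharged**; count-neutral;
one finite four-torus at fixed ε — NOT ℝ⁴, NOT infinite volume, NOT OS, NOT a mass gap, NOT Clay.
-/

set_option autoImplicit false

namespace Summit.QuantumFields.YangMills.BalabanUVNodes.N16AtRecord

open Literature.MathematicalPhysics.QuantumFieldTheory.Balaban1983to89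
open Literature.MathematicalPhysics.QuantumFieldTheory.Balaban1983to89.T4Continuum (T4Family ULoop)
open B7Prop1Explicit B7Prop2Explicit
open T4AveragingDeficitWallBoundary (IsPeriodicCfg)
open Summit.QuantumFields.BalabanUV.T4Continuum
open MinimalActionRate (sfClass)
open MinimalActionWitness (flatCfg)
open BlockAverageCurrent (curConst)
open NE3EnergyShapes (IsUnitarySite)
open NE3EnergyWeightedCovShape (NE3EnergyRateWCov)
open NE3RightInverseSupLetters (frameC)
open NE3.PairLandauB8Avg (PairLandauGaugeB8Avg)
open NE3.LeafIndexSockets (LeafH3sup)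
open YMDAG.UVSplit (Datum NE3Carriers RateCarriers RateRecordPred N16At RatesAt S_N16)
open Summit.QuantumFields.YangMills.BalabanUVNodes.N16 (n16_constant_of_record n16_flatStratum)

noncomputable section

variable {N : ℕ} [NeZero N]

/-! ## §1 READINGS: the stub unfolded, antitone in `RRec`, the projection of `RatesAt`, monotone in the constants -/

/-- **What `S_N16 RRec` says** (`Iff.rfl`): at every rate-carrier bundle of record of every tuned run of every datum, N16's record decl holds at the NE3
sub-bundle. [folklore] -/
theorem s_N16_iff (RRec : RateRecordPred N) :
    S_N16 RRec ↔ ∀ (F : T4Family) (D : Datum F N) (g₀ : ℕ → ℝ) (os : List (ULoop F)) (R : RateCarriers N), RRec F D g₀ os R → N16At R.ne3 :=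
  Iff.rfl

omit [NeZero N] in
/-- **What `N16At c` says** (`Iff.rfl`): the covariant root `NE3EnergyRateWCov` at `d = 4` over the genuine small-field class with the bundle's letters. [folklore] -/
theorem n16At_iff (c : NE3Carriers N) :
    N16At c ↔ NE3EnergyRateWCov 4 (sfClass 4 c.L c.Nper c.ε) c.L c.Nper c.b c.g c.C c.Λ₁ c.Λ₂' c.dom :=
  Iff.rfl

/-- **`S_N16` is ANTITONE in the rate-record predicate**: proved at `RRec`, it holds at every `RRec'` refining `RRec`. [folklore] -/
theorem s_N16_antitone {RRec RRec' : RateRecordPred N}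
    (hle : ∀ (F : T4Family) (D : Datum F N) (g₀ : ℕ → ℝ) (os : List (ULoop F)) (R : RateCarriers N), RRec' F D g₀ os R → RRec F D g₀ os R)
    (h : S_N16 RRec) : S_N16 RRec' :=
  fun F D g₀ os R hR => h F D g₀ os R (hle F D g₀ os R hR)

/-- N16's conjunct of K4's conclusion `RatesAt D R` (projection). [folklore] -/
theorem ratesAt_n16 {F : T4Family} {D : Datum F N} {R : RateCarriers N} (h : RatesAt D R) : N16At R.ne3 :=
  h.2.2.1

omit [NeZero N] in
/-- **`N16At` is MONOTONE in the three constants** `C ≤ C'`, `Λ₁ ≤ Λ₁'`, `Λ₂' ≤ Λ₂''` (`NE3EnergyRateWCov.mono`): the instancer may pin any upper bounds. [folklore] -/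
theorem n16At_mono {c : NE3Carriers N} (h : N16At c) {C' Λ₁' Λ₂'' : ℝ} (hC : c.C ≤ C') (hΛ₁ : c.Λ₁ ≤ Λ₁') (hΛ₂ : c.Λ₂' ≤ Λ₂'') :
    N16At ⟨c.L, c.Nper, c.ε, c.b, c.g, C', Λ₁', Λ₂'', c.dom⟩ :=
  NE3EnergyRateWCov.mono h hC hΛ₁ hΛ₂

/-! ## §2 CLOSERS, refinement-generic: the slot «pinned in THE END's regime with the interfaces», and `S_N16` for every `RRec` carrying it -/

/-- **THE SLOT — `N16At` AT EVERY BUNDLE PINNED IN THE END's REGIME AT WHICH THE INTERFACES HOLD** (block factor `L ≥ 2`, period `Nper ≥ 1`): there are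
`r > 0` and `Cof` with `0 ≤ Cof g` (functions of `(L, Nper, N)`; file 1's `n16_constant_of_record` + choice) such that every `c : NE3Carriers N` with `c.L = L`,
`c.Nper = Nper`, `0 < c.g`, `0 < c.ε ≤ r`, `0 ≤ c.Λ₁ ≤ r`, `0 ≤ c.b ≤ c.ε∕2`, `Cof c.g ≤ c.C`, at which `PairLandauGaugeB8Avg 4 (sfClass 4 L Nper c.ε) L Nper c.b c.g
c.Λ₁ c.Λ₂' 1 c.dom` (N05) and `LeafH3sup 4 L Nper c.ε b′ c′ c.dom` for some leaf letters on (Rb) and the `c′`-line (N07) hold, satisfies `N16At c`. [folklore] -/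
theorem n16At_of_pinned {L Nper : ℕ} (hL : 2 ≤ L) (hN : 1 ≤ Nper) :
    ∃ r : ℝ, 0 < r ∧ ∃ Cof : ℝ → ℝ, (∀ g, 0 < g → 0 ≤ Cof g) ∧
      ∀ c : NE3Carriers N, c.L = L → c.Nper = Nper → 0 < c.g → 0 < c.ε → c.ε ≤ r → 0 ≤ c.Λ₁ → c.Λ₁ ≤ r → 0 ≤ c.b → c.b ≤ c.ε / 2 →
        Cof c.g ≤ c.C →
        PairLandauGaugeB8Avg 4 (sfClass 4 c.L c.Nper c.ε) c.L c.Nper c.b c.g c.Λ₁ c.Λ₂' 1 c.dom →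
        (∃ b' c' : ℝ, 0 ≤ b' ∧ 0 ≤ c' ∧ 2 ^ 15 * ((4 : ℝ) + 1) ^ 2 * ((4 : ℝ) + 4) ^ 2 * (c.L : ℝ) ^ 2 * b' ≤ 1 ∧
          23040 * (4 : ℝ) ^ 4 * (frameC 4 c.L + 4) ^ 3 * (c' + curConst 4 c.L * b' ^ 2) ≤ 1 ∧ LeafH3sup 4 c.L c.Nper c.ε b' c' c.dom) →
        N16At c := by
  haveI : Nonempty (Fin N) := ⟨⟨0, Nat.pos_of_ne_zero (NeZero.ne N)⟩⟩
  obtain ⟨r, hr0, hr⟩ := n16_constant_of_record (n := Fin N) hL hN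
  choose Cof hCof0 hCof using hr
  refine ⟨r, hr0, fun g => if h : 0 < g then Cof h else 0, fun g hg => by simp only [dif_pos hg]; exact hCof0 hg, ?_⟩
  rintro ⟨cL, cN, ε, b, g, C, Λ₁, Λ₂', dom⟩ rfl rfl hg hε hεr hs₁ hs₁r hb hbh hC hB8 ⟨b', c', hb', hc', hRb, hcF, h3⟩
  simp only [dif_pos hg] at hC
  exact (hCof hg hb' hc' hRb hcF hε hεr hs₁ hs₁r hb hbh Λ₂' hB8 h3).mono hC le_rfl le_rfl

/-- **REFINEMENT-GENERIC CLOSER — `S_N16 RRec` FOR EVERY RATE-RECORD PREDICATE CARRYING THE SLOT**: if `RRec F D g₀ os R` forces `R.ne3` to have block factor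
`L`, period `Nper`, letters in THE END's regime (radius `r`, constant `≥ Cof R.ne3.g` of `n16At_of_pinned`) and the two interfaces at its letters, then
`S_N16 RRec`.  This is the ONE clause NODE 00's instancing of `NE3Carriers` must carry for N16; nothing is asserted about the record's `RRec` (none exists).
[folklore] -/
theorem s_N16_of_pinned {L Nper : ℕ} (hL : 2 ≤ L) (hN : 1 ≤ Nper) :
    ∃ r : ℝ, 0 < r ∧ ∃ Cof : ℝ → ℝ, (∀ g, 0 < g → 0 ≤ Cof g) ∧ ∀ RRec : RateRecordPred N,
      (∀ (F : T4Family) (D : Datum F N) (g₀ : ℕ → ℝ) (os : List (ULoop F)) (R : RateCarriers N), RRec F D g₀ os R →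
        R.ne3.L = L ∧ R.ne3.Nper = Nper ∧ 0 < R.ne3.g ∧ 0 < R.ne3.ε ∧ R.ne3.ε ≤ r ∧ 0 ≤ R.ne3.Λ₁ ∧ R.ne3.Λ₁ ≤ r ∧ 0 ≤ R.ne3.b ∧
        R.ne3.b ≤ R.ne3.ε / 2 ∧ Cof R.ne3.g ≤ R.ne3.C ∧
        PairLandauGaugeB8Avg 4 (sfClass 4 R.ne3.L R.ne3.Nper R.ne3.ε) R.ne3.L R.ne3.Nper R.ne3.b R.ne3.g R.ne3.Λ₁ R.ne3.Λ₂' 1 R.ne3.dom ∧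
        (∃ b' c' : ℝ, 0 ≤ b' ∧ 0 ≤ c' ∧ 2 ^ 15 * ((4 : ℝ) + 1) ^ 2 * ((4 : ℝ) + 4) ^ 2 * (R.ne3.L : ℝ) ^ 2 * b' ≤ 1 ∧
          23040 * (4 : ℝ) ^ 4 * (frameC 4 R.ne3.L + 4) ^ 3 * (c' + curConst 4 R.ne3.L * b' ^ 2) ≤ 1 ∧
          LeafH3sup 4 R.ne3.L R.ne3.Nper R.ne3.ε b' c' R.ne3.dom)) →
      S_N16 RRec := by
  obtain ⟨r, hr0, Cof, hCof0, hAt⟩ := n16At_of_pinned (N := N) hL hN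
  refine ⟨r, hr0, Cof, hCof0, fun RRec hpin F D g₀ os R hR => ?_⟩
  obtain ⟨h1, h2, h3, h4, h5, h6, h7, h8, h9, h10, hB8, h3L⟩ := hpin F D g₀ os R hR
  exact hAt R.ne3 h1 h2 h3 h4 h5 h6 h7 h8 h9 h10 hB8 h3L

/-! ## §3 GUARDS: the flat-stratum bundle is INHABITED in `N16At`; an inhabited `RRec` at which `S_N16` holds; the empty predicate -/

/-- **INHABITED RIDER — THE FLAT-STRATUM BUNDLE SATISFIES `N16At`** (`L, Nper ≥ 1`, `ε, C, Λ₁, Λ₂' ≥ 0`, any `b g`): the bundle whose datum set is the flat stratum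
`FS_Nper = {1^{w} : w unitary, Nper-periodic}` of the genuine class (g0's `n16_flatStratum`, witness `Z = 0`). [folklore] -/
theorem n16At_flatStratum {L Nper : ℕ} (hL : 1 ≤ L) (hN : 1 ≤ Nper) {ε : ℝ} (hε : 0 ≤ ε) (b g : ℝ) {C Λ₁ Λ₂' : ℝ}
    (hC : 0 ≤ C) (hΛ₁ : 0 ≤ Λ₁) (hΛ₂' : 0 ≤ Λ₂') :
    N16At (⟨L, Nper, ε, b, g, C, Λ₁, Λ₂',
      {v : Site 4 → Fin 4 → (Matrix (Fin N) (Fin N) ℂ)ˣ | IsPeriodicCfg v (Nper : ℤ) ∧ ∃ w : Site 4 → (Matrix (Fin N) (Fin N) ℂ)ˣ,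
        IsUnitarySite w ∧ v = gaugeAct w flatCfg}⟩ : NE3Carriers N) := by
  haveI : Nonempty (Fin N) := ⟨⟨0, Nat.pos_of_ne_zero (NeZero.ne N)⟩⟩
  exact n16_flatStratum (n := Fin N) hL hN hε b g hC hΛ₁ hΛ₂'

/-- **AN INHABITED RATE-RECORD PREDICATE AT WHICH `S_N16` IS A THEOREM** (typing witness, not the record): «`R.ne3`'s datum set is the flat stratum of its
class, `L, Nper ≥ 1`, `ε, C, Λ₁, Λ₂' ≥ 0`». [folklore] -/
theorem s_N16_flatRecord :
    S_N16 (N := N) fun _ _ _ _ R =>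
      1 ≤ R.ne3.L ∧ 1 ≤ R.ne3.Nper ∧ 0 ≤ R.ne3.ε ∧ 0 ≤ R.ne3.C ∧ 0 ≤ R.ne3.Λ₁ ∧ 0 ≤ R.ne3.Λ₂' ∧
      R.ne3.dom = {v : Site 4 → Fin 4 → (Matrix (Fin N) (Fin N) ℂ)ˣ | IsPeriodicCfg v (R.ne3.Nper : ℤ) ∧
        ∃ w : Site 4 → (Matrix (Fin N) (Fin N) ℂ)ˣ, IsUnitarySite w ∧ v = gaugeAct w flatCfg} := by
  rintro F D g₀ os ⟨ne1, ne2, ⟨L, Nper, ε, b, g, C, Λ₁, Λ₂', dom⟩, u3⟩ ⟨hL, hN, hε, hC, hΛ₁, hΛ₂', hdom⟩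
  dsimp only at hL hN hε hC hΛ₁ hΛ₂' hdom ⊢
  subst hdom
  exact n16At_flatStratum hL hN hε b g hC hΛ₁ hΛ₂'

/-- **THE EMPTY PREDICATE CLOSES VACUOUSLY** — recorded so that no reader mistakes a closer over an uninhabited `RRec` for content: K4's existence content is
`S_R00x Rec RRec`, not `S_N16`. [folklore] -/
theorem s_N16_of_empty : S_N16 (N := N) fun _ _ _ _ _ => False :=
  fun _ _ _ _ _ h => h.elim

/-! ## §4 THE FACE AT THE RECORD the K5 consumers read -/

/-- **AT EVERY BUNDLE OF RECORD, THE COVARIANT ROOT** — under `S_N16 RRec` the consumers' hypothesis `hcov : NE3EnergyRateWCov 4 (sfClass 4 L Nper ε) L Nper b g C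
Λ₁ Λ₂' dom` (N19's closeness via `CovariantRoot.closeness_of_ne3EnergyRateWCov`, N21's `BalabanUVNodesN21SlotSupJunction`) holds with the bundle's letters.
`Iff.rfl` bookkeeping. [folklore] -/
theorem covRoot_at_record {RRec : RateRecordPred N} (h : S_N16 RRec) {F : T4Family} {D : Datum F N} {g₀ : ℕ → ℝ} {os : List (ULoop F)}
    {R : RateCarriers N} (hR : RRec F D g₀ os R) :
    NE3EnergyRateWCov 4 (sfClass 4 R.ne3.L R.ne3.Nper R.ne3.ε) R.ne3.L R.ne3.Nper R.ne3.b R.ne3.g R.ne3.C R.ne3.Λ₁ R.ne3.Λ₂' R.ne3.dom :=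
  h F D g₀ os R hR

end

end Summit.QuantumFields.YangMills.BalabanUVNodes.N16AtRecord
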